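import Summits.QuantumAdvantage.QuantumAdvantage.Statement
import Summits.QuantumAdvantage.QuantumAdvantage.Theorems.SoloBlindCeiling
import Summits.QuantumAdvantage.QuantumAdvantage.Theorems.SoloBlindLattice
import Literature.Computability.Complexity.DTIMEPowSsubsetP
import Literature.Computability.Complexity.ProbabilisticClassesProofs
import HarnessLib

/-!
# The inheritance frontier of `QuantumAdvantage`

`QuantumAdvantage` is `¬ (BQP ⊆ BPP)` (`soloBlind_quantumAdvantage_iff_not_subset`). Call an
unconditional lower bound "`BQP ⊄ C`" INHERITED if it already follows from a classical bound
`P ⊄ C` (or `BPP ⊄ C`) through the proved sandwich `P ⊆ BPP ⊆ BQP`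
(`soloBlind_inherit_of_not_P_subset`, `soloBlind_inherit_of_not_BPP_subset`). This file records,
sorry-free and over the tree's own classes:

* the strongest HYPOTHESIS-FREE lower bound on `BQP` the tree proves — for every `k`,
  some `BQP` language is not in `DTIME(nᵏ)` (`soloBlind_exists_mem_BQP_not_mem_DTIME_pow`,
  `soloBlind_not_BQP_subset_DTIME_pow`) — and the fact that it is inherited verbatim from the
  deterministic time hierarchy (`exists_mem_P_not_mem_DTIME_pow`, Hartmanis–Stearns 1965 Cor. 9.1);
* the kernel shadow of the "inheritance frontier": ANY bound `BQP ⊄ C` yields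
  `Summit ∨ BPP ⊄ C` (`soloBlind_summit_or_of_not_BQP_subset`), so a NON-inherited bound — one with
  `P ⊆ C` — yields `Summit ∨ BPP ⊄ P` (`soloBlind_nonInherited`), and the existence of a
  non-inherited bound is EXACTLY the lowest rung `BQP ⊄ P` of `SoloBlindLattice.lean`
  (`soloBlind_exists_nonInherited_iff`); under full derandomisation `BPP ⊆ P` it is exactly the
  summit (`soloBlind_exists_nonInherited_iff_summit_of_derand`), and unconditionally the summit is
  the existence of a bound not inherited from `BPP` (`soloBlind_summit_iff_exists_notFromBPP`).

Reading (prose claim of the accompanying wall, not a theorem): every unconditional theorem of the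
form "`BQP ⊄ C`" presently known for a uniform classical class `C` is inherited in this sense
(`C = DTIME(nᵏ)`, and the non-uniform constant-depth classes where the classical bound is a
`P`-function such as parity or majority); the first non-inherited bit in any direction — time
(`BQP ⊄ ZPTIME(n)` with `P ⊄ ZPTIME(n)` open), circuits (`BQP ⊄` uniform `TC⁰`), space
(`BQP ⊄ L`) — would by `soloBlind_nonInherited` already decide `Summit ∨ P ≠ BPP`.

References: J. Hartmanis, R. E. Stearns, *On the computational complexity of algorithms*,
Trans. AMS 117 (1965), Cor. 9.1; S. Arora, B. Barak, *Computational Complexity* (2009), Thm. 3.1,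
§7.5, §10.4 (`BPP ⊆ BQP`); E. Bernstein, U. Vazirani, *Quantum complexity theory*, SIAM J. Comput.
26 (1997), §8 (`P ⊆ BPP ⊆ BQP ⊆ P^{#P}`).
-/

namespace Summit.QuantumAdvantage.QuantumAdvantage.Theorems

open Literature.Computability.Complexity Literature.Computability.Complexity.Classes
  Literature.Computability.Cryptography Literature.Computability.QuantumComplexity

/-! ### Inheritance through the sandwich `P ⊆ BPP ⊆ BQP` -/

/-- A classical bound `BPP ⊄ C` is inherited by `BQP` (tree: `BPP ⊆ BQP`). -/
theorem soloBlind_inherit_of_not_BPP_subset {C : Set (Language Bool)} (h : ¬ (BPP ⊆ C)) :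
    ¬ (BQP ⊆ C) :=
  fun hQC => h (BPP_subset_BQP_holds.trans hQC)

/-- A classical bound `P ⊄ C` is inherited by `BQP` (tree: `P ⊆ BPP ⊆ BQP`). -/
theorem soloBlind_inherit_of_not_P_subset {C : Set (Language Bool)} (h : ¬ (P ⊆ C)) :
    ¬ (BQP ⊆ C) :=
  soloBlind_inherit_of_not_BPP_subset fun hBC => h (P_subset_BPP_holds.trans hBC)

/-! ### The strongest hypothesis-free lower bound on `BQP` in the tree — and it is inherited -/

/-- **For every `k`, some `BQP` language is not decidable in deterministic time `nᵏ`**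
(hypothesis-free; inherited from `exists_mem_P_not_mem_DTIME_pow`). -/
theorem soloBlind_exists_mem_BQP_not_mem_DTIME_pow (k : ℕ) :
    ∃ L ∈ BQP, L ∉ DTIME (fun n => n ^ k) := by
  obtain ⟨L, hLP, hL⟩ := exists_mem_P_not_mem_DTIME_pow k
  exact ⟨L, BPP_subset_BQP_holds (P_subset_BPP_holds hLP), hL⟩

/-- `BQP ⊄ DTIME(nᵏ)` for every `k` (hypothesis-free, inherited). -/
theorem soloBlind_not_BQP_subset_DTIME_pow (k : ℕ) : ¬ (BQP ⊆ DTIME (fun n => n ^ k)) :=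
  soloBlind_inherit_of_not_P_subset (not_P_subset_DTIME_pow k)

/-- In particular no fixed polynomial deterministic time bound captures `BQP`:
`DTIME(nᵏ) ≠ BQP`. -/
theorem soloBlind_DTIME_pow_ne_BQP (k : ℕ) : DTIME (fun n => n ^ k) ≠ BQP :=
  fun h => soloBlind_not_BQP_subset_DTIME_pow k (h ▸ subset_rfl)

/-! ### The frontier: what a non-inherited bound would give -/

/-- Any bound `BQP ⊄ C` gives `Summit ∨ BPP ⊄ C` (no hypothesis on `C`). -/
theorem soloBlind_summit_or_of_not_BQP_subset {C : Set (Language Bool)} (hq : ¬ (BQP ⊆ C)) :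
    _root_.QuantumAdvantage ∨ ¬ (BPP ⊆ C) := by
  rw [soloBlind_quantumAdvantage_iff_not_subset]
  by_contra h
  obtain ⟨h₁, h₂⟩ := not_or.1 h
  exact hq ((not_not.1 h₁).trans (not_not.1 h₂))

/-- **A non-inherited bound decides `Summit ∨ P ≠ BPP`.** If `BQP ⊄ C` for a class `C ⊇ P`
(so the bound is not inherited from `P`), then the summit holds or `BPP ⊄ P`. -/
theorem soloBlind_nonInherited {C : Set (Language Bool)} (hq : ¬ (BQP ⊆ C)) (hp : P ⊆ C) :
    _root_.QuantumAdvantage ∨ ¬ (BPP ⊆ P) :=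
  (soloBlind_summit_or_of_not_BQP_subset hq).imp_right fun h hBP => h (hBP.trans hp)

/-- The existence of a bound on `BQP` not inherited from `P` is exactly the lowest rung
`BQP ⊄ P`, i.e. `Summit ∨ BPP ⊄ P` (`soloBlind_not_BQP_subset_P_iff`). -/
theorem soloBlind_exists_nonInherited_iff :
    (∃ C : Set (Language Bool), P ⊆ C ∧ ¬ (BQP ⊆ C)) ↔
      _root_.QuantumAdvantage ∨ ¬ (BPP ⊆ P) := by
  constructor
  · rintro ⟨C, hp, hq⟩
    exact soloBlind_nonInherited hq hp
  · intro h
    exact ⟨P, subset_rfl, soloBlind_not_BQP_subset_P_iff.2 h⟩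

/-- Under full derandomisation `BPP ⊆ P`, the summit is EXACTLY the existence of a lower bound on
`BQP` not inherited from `P`. -/
theorem soloBlind_exists_nonInherited_iff_summit_of_derand (hBP : BPP ⊆ P) :
    (∃ C : Set (Language Bool), P ⊆ C ∧ ¬ (BQP ⊆ C)) ↔ _root_.QuantumAdvantage := by
  rw [soloBlind_exists_nonInherited_iff]
  exact ⟨fun h => h.elim id fun h' => (h' hBP).elim, Or.inl⟩

/-- Unconditionally, the summit is exactly the existence of a lower bound on `BQP` not inherited
from `BPP`. -/
theorem soloBlind_summit_iff_exists_notFromBPP :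
    _root_.QuantumAdvantage ↔ ∃ C : Set (Language Bool), BPP ⊆ C ∧ ¬ (BQP ⊆ C) := by
  rw [soloBlind_quantumAdvantage_iff_not_subset]
  exact ⟨fun h => ⟨BPP, subset_rfl, h⟩,
    fun ⟨C, hB, hq⟩ hQB => hq (hQB.trans hB)⟩

end Summit.QuantumAdvantage.QuantumAdvantage.Theorems
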